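import Mathlib.Tactic.Group
import Literature.AnabelianGeometry.EtaleTheta.ThetaSubquotientGroup
import Literature.AnabelianGeometry.EtaleTheta.FrobenioidTheta
import Literature.AlgebraicGeometry.Frobenioids.QuasiTemperoidInductionFunctor

/-!
# [EtTh] §5: the theta subquotients `(l·Δ_Θ)_D` over `B^temp(Π)⁰` (instance of `ThetaSubquotientStub`)

Mochizuki, *The étale theta function and its Frobenioid-theoretic manifestations*, Publ. RIMS **45**
(2009), §5 p. 327 (PDF p. 101) [cite: MochizukiEtTh2009, §5 p.327 (PDF p.101)]: "for `D ∈ Ob(D)`, these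
subquotients [`Π^tp_X ↠ (Π^tp_X)^Θ ⊇ l·Δ_Θ`] determine subquotients `Aut_D(D) ↠ Aut^Θ_D(D)`;
`(l·Δ_Θ)_D ⊆ Aut^Θ_D(D)` which are preserved by arbitrary self-equivalences of `D`".  abc-iut cell, layer L2,
seat abc-iut-L2-t9, unit W2-L2-05 (merge adapter): the REAL instance, for the base category
`D = B^temp(Π)⁰` (abc-iut-L3-t2's `SemiGraphs.BTemp`, connected part `Frobenioids.ConnectedPart`), of
abc-iut-L2-t4's data stub `FrobenioidTheta.ThetaSubquotientStub D` (`FrobenioidTheta.lean`, FROZEN v4):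
`lDelta : D → Type`, an abelian group `(l·Δ_Θ)_E` for EVERY object, with a transport `lDeltaMap` along EVERY
morphism.  Reading **R2** (decision of the §5 owner abc-iut-L2-t4, INBOX 2026-08-25T23:12:55Z, on this
seat's finding W2-L2-05/B that `Aut_D(−)` is not functorial along arbitrary morphisms, so that a
subquotient-of-`Aut` has no all-morphism transport): the CHOICE-FREE COVARIANT functor

  `(l·Δ_Θ)_E := { compatible families (t_x)_{x ∈ E}, t_x ∈ Λ / ι⁻¹J(Stab x) } `,
  `J(S) = (q(S) ∩ L)·[L, q(S)]` (`ThetaSubquotientGroup.lean`),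

"compatible" meaning `t_{g·x} ≡ q(g) t_x q(g)⁻¹`; realised concretely as the quotient of the group `Fam E`
of compatible functions `E → Λ` by the pointwise-null ones `Null E` (no dependent products, no choice of
base point).  Push-forward along `f : E → E'` of connected objects evaluates a family at any preimage
(`map`; independence of the preimage is exactly what the commutator term of `J` buys — `pushHom_mem_fam`).
`thetaSubquotientStub q ι : ThetaSubquotientStub (ConnectedPart (BTemp Π))` packages `(lDelta, lDeltaMap)`.

What this is and is not, honestly (as requested by abc-iut-L2-t4): at a GALOIS object `E ≅ Π/N` the carrier
is `Λ/ι⁻¹(q(N) ∩ L) ≅ L·q(N)/q(N)`, print's subquotient of `Aut_D(E) = Π/N` on the nose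
(`ThetaSubquotientGroup.killQ_eq_of_normal`; companions: `ThetaSubquotientOfTemperedGalois.lean` —
evaluation at a point, functoriality, Galois points; `ThetaSubquotientOfTemperedAut.lean` — print's
subquotient of `Aut_D(E)` maps in canonically, ONTO at Galois objects); at a NON-Galois object it is the
coinvariant ENLARGEMENT of print's subquotient-of-`Aut`, which it receives by that canonical homomorphism.  Every object at which
§5 evaluates `(l·Δ_Θ)_(−)` (the `N`-codomains, `B_N`) has Galois base in print's usage (abc-iut-L2-t4, loc.
cit.); Def. 5.4 (b) is read through this carrier elsewhere.  Nothing here asserts anything about the curves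
of [EtTh]; `Π`, `q`, `ι` are parameters (`Π^tp_X`, `Π^tp_X ↠ (Π^tp_X)^Θ`, `l·Δ_Θ ↪ (Π^tp_X)^Θ` in §5).
-/

noncomputable section

namespace Literature.AnabelianGeometry.EtaleTheta

namespace ThetaSubquotient

open CategoryTheory Literature.AlgebraicGeometry.Frobenioids Literature.AnabelianGeometry.SemiGraphs
open Literature.AlgebraicGeometry.Frobenioids.QuasiTemperoid (stabilizerSubgroup)
open Literature.AlgebraicGeometry.Frobenioids.QuasiTemperoid.BTempConnected (hom_ρ ρ_mul_apply
  ρ_one_apply ρ_inv_apply ρ_apply_inv exists_ρ_eq_of_isConnectedObj surjective_of_isConnectedObj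
  nonempty_of_isConnectedObj)

universe u v w

variable {G : Type u} [Group G] [TopologicalSpace G] {Q : Type v} [Group Q] {Λ : Type w}
  [CommGroup Λ] (q : G →* Q) (ι : Λ →* Q)

/-! ### Stabilisers along the action and along morphisms -/

/-- `Stab(g·x) ⊇ g·Stab(x)·g⁻¹`. [cite: MochizukiEtTh2009, §5 p.327 (PDF p.101)] -/
theorem conj_mem_stabilizerSubgroup (E : BTemp G) (g : G) (x : E.obj.V) :
    ∀ s ∈ stabilizerSubgroup E x, g * s * g⁻¹ ∈ stabilizerSubgroup E (E.obj.ρ g x) := by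
  intro s hs
  change E.obj.ρ (g * s * g⁻¹) (E.obj.ρ g x) = E.obj.ρ g x
  rw [ρ_mul_apply, ρ_mul_apply, ρ_inv_apply, show E.obj.ρ s x = x from hs]

/-- `Stab(x) ⊆ Stab(f x)` for a `Π`-map `f`. [cite: MochizukiEtTh2009, §5 p.327 (PDF p.101)] -/
theorem stabilizerSubgroup_le_of_hom {E E' : BTemp G} (f : E ⟶ E') (x : E.obj.V) :
    stabilizerSubgroup E x ≤ stabilizerSubgroup E' (f.hom.hom x) := by
  intro s hs
  change E'.obj.ρ s (f.hom.hom x) = f.hom.hom x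
  rw [← hom_ρ, show E.obj.ρ s x = x from hs]

/-- Elements of `L = ι(Λ)` commute. [cite: MochizukiEtTh2009, §5 p.327 (PDF p.101)] -/
theorem range_comm {a b : Q} (ha : a ∈ ι.range) (hb : b ∈ ι.range) : a * b = b * a := by
  obtain ⟨a, rfl⟩ := ha
  obtain ⟨b, rfl⟩ := hb
  rw [← map_mul, mul_comm, map_mul]

/-- `ι(a) ∈ L`. [cite: MochizukiEtTh2009, §5 p.327 (PDF p.101)] -/
theorem mem_range_self (a : Λ) : ι a ∈ ι.range := ⟨a, rfl⟩

/-- `L` is normal: `c·ι(a)·c⁻¹ ∈ L`. [cite: MochizukiEtTh2009, §5 p.327 (PDF p.101)] -/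
theorem conj_mem_range [h : ι.range.Normal] (c : Q) (a : Λ) : c * ι a * c⁻¹ ∈ ι.range :=
  h.conj_mem _ (mem_range_self ι a) c

/-! ### Compatible families of classes and the carrier `(l·Δ_Θ)_E` -/

section Families

variable (E : BTemp G)

/-- The pointwise-null functions `E → Λ`: `t` with `ι(t_x) ∈ J(Stab x)` for every point `x` (they represent
the trivial family). [cite: MochizukiEtTh2009, §5 p.327 (PDF p.101)] -/
def Null : Subgroup (E.obj.V → Λ) where
  carrier := {t | ∀ x, ι (t x) ∈ killQ q ι (stabilizerSubgroup E x)}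
  one_mem' x := by simp
  mul_mem' {t s} ht hs x := by
    simpa only [Pi.mul_apply, map_mul] using (killQ q ι _).mul_mem (ht x) (hs x)
  inv_mem' {t} ht x := by
    simpa only [Pi.inv_apply, map_inv] using (killQ q ι _).inv_mem (ht x)

/-- Membership in `Null`. [cite: MochizukiEtTh2009, §5 p.327 (PDF p.101)] -/
theorem mem_null_iff {t : E.obj.V → Λ} :
    t ∈ Null q ι E ↔ ∀ x, ι (t x) ∈ killQ q ι (stabilizerSubgroup E x) := Iff.rfl

variable [ι.range.Normal]

/-- The **compatible families**: functions `t : E → Λ` with `t_{g·x} ≡ q(g)·t_x·q(g)⁻¹` modulo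
`J(Stab(g·x))` for all `g ∈ Π`, `x ∈ E` — the transport of the subquotient datum along the `Π`-action
("preserved by arbitrary self-equivalences", p.327 (PDF p.101)). A subgroup because `L` is abelian and
normal.
[cite: MochizukiEtTh2009, §5 p.327 (PDF p.101)] -/
def Fam : Subgroup (E.obj.V → Λ) where
  carrier := {t | ∀ (g : G) (x : E.obj.V),
    (ι (t (E.obj.ρ g x)))⁻¹ * (q g * ι (t x) * (q g)⁻¹) ∈ killQ q ι (stabilizerSubgroup E (E.obj.ρ g x))}
  one_mem' g x := by simp
  mul_mem' {t s} ht hs g x := by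
    have h1 := ht g x
    have h2 := hs g x
    have hc : q g * ι (t x) * (q g)⁻¹ ∈ ι.range := conj_mem_range ι (q g) (t x)
    have hB : (ι (s (E.obj.ρ g x)))⁻¹ ∈ ι.range := ι.range.inv_mem (mem_range_self ι _)
    have hA : (ι (t (E.obj.ρ g x)))⁻¹ * (q g * ι (t x) * (q g)⁻¹) ∈ ι.range :=
      ι.range.mul_mem (ι.range.inv_mem (mem_range_self ι _)) hc
    have key : (ι ((t * s) (E.obj.ρ g x)))⁻¹ * (q g * ι ((t * s) x) * (q g)⁻¹) =
        ((ι (t (E.obj.ρ g x)))⁻¹ * (q g * ι (t x) * (q g)⁻¹)) *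
          ((ι (s (E.obj.ρ g x)))⁻¹ * (q g * ι (s x) * (q g)⁻¹)) := by
      have comm := range_comm ι hB hA
      simp only [Pi.mul_apply, map_mul, mul_inv_rev]
      calc (ι (s (E.obj.ρ g x)))⁻¹ * (ι (t (E.obj.ρ g x)))⁻¹ * (q g * (ι (t x) * ι (s x)) * (q g)⁻¹)
          = ((ι (s (E.obj.ρ g x)))⁻¹ * ((ι (t (E.obj.ρ g x)))⁻¹ * (q g * ι (t x) * (q g)⁻¹))) *
              (q g * ι (s x) * (q g)⁻¹) := by group
        _ = (((ι (t (E.obj.ρ g x)))⁻¹ * (q g * ι (t x) * (q g)⁻¹)) * (ι (s (E.obj.ρ g x)))⁻¹) *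
              (q g * ι (s x) * (q g)⁻¹) := by rw [comm]
        _ = _ := by group
    rw [key]
    exact (killQ q ι _).mul_mem h1 h2
  inv_mem' {t} ht g x := by
    have h1 := (killQ q ι (stabilizerSubgroup E (E.obj.ρ g x))).inv_mem (ht g x)
    have hc : (q g * ι (t x) * (q g)⁻¹)⁻¹ ∈ ι.range := ι.range.inv_mem (conj_mem_range ι (q g) (t x))
    have hA : ι (t (E.obj.ρ g x)) ∈ ι.range := mem_range_self ι _
    have key : (ι (t⁻¹ (E.obj.ρ g x)))⁻¹ * (q g * ι (t⁻¹ x) * (q g)⁻¹) =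
        ((ι (t (E.obj.ρ g x)))⁻¹ * (q g * ι (t x) * (q g)⁻¹))⁻¹ := by
      have comm := range_comm ι hc hA
      simp only [Pi.inv_apply, map_inv, inv_inv, mul_inv_rev]
      calc ι (t (E.obj.ρ g x)) * (q g * (ι (t x))⁻¹ * (q g)⁻¹)
          = ι (t (E.obj.ρ g x)) * (q g * ι (t x) * (q g)⁻¹)⁻¹ := by group
        _ = (q g * ι (t x) * (q g)⁻¹)⁻¹ * ι (t (E.obj.ρ g x)) := comm.symm
        _ = _ := by group
    rw [key]
    exact h1

/-- Membership in `Fam`. [cite: MochizukiEtTh2009, §5 p.327 (PDF p.101)] -/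
theorem mem_fam_iff {t : E.obj.V → Λ} : t ∈ Fam q ι E ↔ ∀ (g : G) (x : E.obj.V),
    (ι (t (E.obj.ρ g x)))⁻¹ * (q g * ι (t x) * (q g)⁻¹) ∈
      killQ q ι (stabilizerSubgroup E (E.obj.ρ g x)) := Iff.rfl

/-- **The carrier `(l·Δ_Θ)_E`**: compatible families modulo null families — an abelian group for EVERY
object `E` of `B^temp(Π)`. [cite: MochizukiEtTh2009, §5 p.327 (PDF p.101)] -/
abbrev LDelta : Type (max u w) := Fam q ι E ⧸ (Null q ι E).subgroupOf (Fam q ι E)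

/-- The class of a compatible family. [cite: MochizukiEtTh2009, §5 p.327 (PDF p.101)] -/
abbrev mk (t : Fam q ι E) : LDelta q ι E := QuotientGroup.mk t

/-- Two compatible families have the same class iff they differ by a null family.
[cite: MochizukiEtTh2009, §5 p.327 (PDF p.101)] -/
theorem mk_eq_mk_iff (t s : Fam q ι E) :
    mk q ι E t = mk q ι E s ↔ ∀ x, (ι ((t : E.obj.V → Λ) x))⁻¹ * ι ((s : E.obj.V → Λ) x) ∈
      killQ q ι (stabilizerSubgroup E x) := by
  rw [QuotientGroup.eq, Subgroup.mem_subgroupOf]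
  simp only [Subgroup.coe_mul, InvMemClass.coe_inv, mem_null_iff, Pi.mul_apply, Pi.inv_apply, map_mul,
    map_inv]

end Families

/-! ### Push-forward along morphisms of connected objects -/

section Push

variable [ι.range.Normal] {E E' : BTemp G} (hE : IsConnectedObj E) (hE' : IsConnectedObj E')
  (f : E ⟶ E')

/-- A preimage under `f` of a point of the connected target (morphisms into connected objects of
`B^temp(Π)` are surjective on points). [cite: MochizukiEtTh2009, §5 p.327 (PDF p.101)] -/
def pre (y : E'.obj.V) : E.obj.V :=
  Classical.choose (surjective_of_isConnectedObj
    (Classical.choice (nonempty_of_isConnectedObj E hE)) hE' f y)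

/-- `f (pre y) = y`. [cite: MochizukiEtTh2009, §5 p.327 (PDF p.101)] -/
theorem apply_pre (y : E'.obj.V) : (f.hom.hom (pre hE hE' f y) : E'.obj.V) = y :=
  Classical.choose_spec (surjective_of_isConnectedObj
    (Classical.choice (nonempty_of_isConnectedObj E hE)) hE' f y)

/-- Push-forward of functions: evaluate at a preimage. [cite: MochizukiEtTh2009, §5 p.327 (PDF p.101)] -/
def pushHom : (E.obj.V → Λ) →* (E'.obj.V → Λ) where
  toFun t y := t (pre hE hE' f y)
  map_one' := rfl
  map_mul' _ _ := rfl

/-- `pushHom` on functions. [cite: MochizukiEtTh2009, §5 p.327 (PDF p.101)] -/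
@[simp] theorem pushHom_apply (t : E.obj.V → Λ) (y : E'.obj.V) :
    pushHom hE hE' f t y = t (pre hE hE' f y) := rfl

omit [ι.range.Normal] in
/-- Null families push forward to null families (`Stab(x) ⊆ Stab(f x)` and `J` is monotone).
[cite: MochizukiEtTh2009, §5 p.327 (PDF p.101)] -/
theorem pushHom_mem_null {t : E.obj.V → Λ} (ht : t ∈ Null q ι E) :
    pushHom hE hE' f t ∈ Null q ι E' := by
  intro y
  have hle : stabilizerSubgroup E (pre hE hE' f y) ≤ stabilizerSubgroup E' y := by
    have h := stabilizerSubgroup_le_of_hom f (pre hE hE' f y)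
    rwa [apply_pre] at h
  exact killQ_mono q ι hle (ht _)

/-- **Independence of the preimage / compatibility of the push-forward**: compatible families push forward
to compatible families.  Two preimages of points in one `Π`-orbit differ by some `k·g` with `k` in the
stabiliser of the target point, and conjugation by `q(k)` is killed by the commutator term of `J`.
[cite: MochizukiEtTh2009, §5 p.327 (PDF p.101)] -/
theorem pushHom_mem_fam {t : E.obj.V → Λ} (ht : t ∈ Fam q ι E) : pushHom hE hE' f t ∈ Fam q ι E' := by
  intro g y
  simp only [pushHom_apply]
  obtain ⟨k, hk⟩ := exists_ρ_eq_of_isConnectedObj E hE (E.obj.ρ g (pre hE hE' f y))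
    (pre hE hE' f (E'.obj.ρ g y))
  -- `k` stabilises `g·y`
  have hk' : E'.obj.ρ k (E'.obj.ρ g y) = E'.obj.ρ g y := by
    have h := congrArg (fun z => (f.hom.hom z : E'.obj.V)) hk
    simp only [hom_ρ] at h
    rw [apply_pre, apply_pre] at h
    exact h
  have hkS : k ∈ stabilizerSubgroup E' (E'.obj.ρ g y) := hk'
  -- the family condition for `t` at `(k·g, pre y)`, transported to `Stab(g·y)`
  have e : (f.hom.hom (E.obj.ρ (k * g) (pre hE hE' f y)) : E'.obj.V) = E'.obj.ρ g y := by
    rw [hom_ρ, apply_pre, ρ_mul_apply, hk']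
  have hle : stabilizerSubgroup E (E.obj.ρ (k * g) (pre hE hE' f y)) ≤
      stabilizerSubgroup E' (E'.obj.ρ g y) := by
    intro s hs
    have h := stabilizerSubgroup_le_of_hom f _ hs
    rwa [e] at h
  have u := killQ_mono q ι hle (ht (k * g) (pre hE hE' f y))
  rw [ρ_mul_apply, hk, map_mul] at u
  -- conjugation by `q k` is trivial modulo `J(Stab(g·y))`
  have hc : (q g * ι (t (pre hE hE' f y)) * (q g)⁻¹)⁻¹ ∈ ι.range :=
    ι.range.inv_mem (conj_mem_range ι (q g) _)
  have v := conj_mul_inv_mem_killQ q ι (S := stabilizerSubgroup E' (E'.obj.ρ g y)) hc hkS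
  have key : (ι (t (pre hE hE' f (E'.obj.ρ g y))))⁻¹ * (q g * ι (t (pre hE hE' f y)) * (q g)⁻¹) =
      (ι (t (pre hE hE' f (E'.obj.ρ g y))))⁻¹ *
          (q k * q g * ι (t (pre hE hE' f y)) * (q k * q g)⁻¹) *
        (q k * (q g * ι (t (pre hE hE' f y)) * (q g)⁻¹)⁻¹ * (q k)⁻¹ *
          (q g * ι (t (pre hE hE' f y)) * (q g)⁻¹)⁻¹⁻¹) := by
    group
  rw [key]
  exact (killQ q ι _).mul_mem u v

/-- Push-forward on compatible families. [cite: MochizukiEtTh2009, §5 p.327 (PDF p.101)] -/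
def famPush : Fam q ι E →* Fam q ι E' :=
  ((pushHom hE hE' f).comp (Fam q ι E).subtype).codRestrict (Fam q ι E') fun t =>
    pushHom_mem_fam q ι hE hE' f t.2

/-- `famPush` on functions. [cite: MochizukiEtTh2009, §5 p.327 (PDF p.101)] -/
@[simp] theorem coe_famPush (t : Fam q ι E) (y : E'.obj.V) :
    (famPush q ι hE hE' f t : E'.obj.V → Λ) y = (t : E.obj.V → Λ) (pre hE hE' f y) := rfl

/-- **The transport `(l·Δ_Θ)_E → (l·Δ_Θ)_{E'}` along a morphism `f : E → E'` of connected objects**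
("`lDeltaMap`"). [cite: MochizukiEtTh2009, §5 p.327 (PDF p.101)] -/
def map : LDelta q ι E →* LDelta q ι E' :=
  QuotientGroup.map _ _ (famPush q ι hE hE' f) fun t ht => by
    rw [Subgroup.mem_comap, Subgroup.mem_subgroupOf]
    exact pushHom_mem_null q ι hE hE' f ht

/-- `map` on classes. [cite: MochizukiEtTh2009, §5 p.327 (PDF p.101)] -/
@[simp] theorem map_mk (t : Fam q ι E) :
    map q ι hE hE' f (mk q ι E t) = mk q ι E' (famPush q ι hE hE' f t) := rfl

/-- **The push-forward evaluates as expected**: the class of `f_* t` at `f x` is the class of `t_x`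
(independence of the chosen preimage).  [cite: MochizukiEtTh2009, §5 p.327 (PDF p.101)] -/
theorem famPush_apply_congr (t : Fam q ι E) (x : E.obj.V) :
    (ι ((famPush q ι hE hE' f t : E'.obj.V → Λ) (f.hom.hom x)))⁻¹ * ι ((t : E.obj.V → Λ) x) ∈
      killQ q ι (stabilizerSubgroup E' (f.hom.hom x)) := by
  rw [coe_famPush]
  obtain ⟨k, hk⟩ := exists_ρ_eq_of_isConnectedObj E hE x (pre hE hE' f (f.hom.hom x))
  have hk' : E'.obj.ρ k (f.hom.hom x) = f.hom.hom x := by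
    have h := congrArg (fun z => (f.hom.hom z : E'.obj.V)) hk
    simp only [hom_ρ] at h
    rw [apply_pre] at h
    exact h
  have hkS : k ∈ stabilizerSubgroup E' (f.hom.hom x) := hk'
  have e : (f.hom.hom (E.obj.ρ k x) : E'.obj.V) = f.hom.hom x := by rw [hom_ρ, hk']
  have hle : stabilizerSubgroup E (E.obj.ρ k x) ≤ stabilizerSubgroup E' (f.hom.hom x) := by
    intro s hs
    have h := stabilizerSubgroup_le_of_hom f _ hs
    rwa [e] at h
  have u := killQ_mono q ι hle (t.2 k x)
  rw [hk] at u
  have hc : (ι ((t : E.obj.V → Λ) x))⁻¹ ∈ ι.range := ι.range.inv_mem (mem_range_self ι _)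
  have v := conj_mul_inv_mem_killQ q ι (S := stabilizerSubgroup E' (f.hom.hom x)) hc hkS
  have key : (ι ((t : E.obj.V → Λ) (pre hE hE' f (f.hom.hom x))))⁻¹ * ι ((t : E.obj.V → Λ) x) =
      (ι ((t : E.obj.V → Λ) (pre hE hE' f (f.hom.hom x))))⁻¹ *
          (q k * ι ((t : E.obj.V → Λ) x) * (q k)⁻¹) *
        (q k * (ι ((t : E.obj.V → Λ) x))⁻¹ * (q k)⁻¹ * (ι ((t : E.obj.V → Λ) x))⁻¹⁻¹) := by
    group
  rw [key]
  exact (killQ q ι _).mul_mem u v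

end Push

/-! ### The instance of `ThetaSubquotientStub` over `B^temp(Π)⁰` -/

/-- **The theta subquotients over `D = B^temp(Π)⁰`** as an instance of abc-iut-L2-t4's
`FrobenioidTheta.ThetaSubquotientStub D`: `lDelta E := (l·Δ_Θ)_E` (compatible families modulo null ones),
`lDeltaMap f :=` push-forward along `f`.  Parameters: `q : Π → Q` (`Π^tp_X ↠ (Π^tp_X)^Θ`) and
`ι : Λ → Q` (`l·Δ_Θ ↪ (Π^tp_X)^Θ`, abelian with normal image).
[cite: MochizukiEtTh2009, §5 p.327 (PDF p.101)] -/
def thetaSubquotientStub [ι.range.Normal] :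
    FrobenioidTheta.ThetaSubquotientStub.{max u w} (ConnectedPart (BTemp G)) where
  lDelta E := LDelta q ι E.obj
  instCommGroupLDelta _ := inferInstance
  lDeltaMap {E E'} f := map q ι E.property E'.property f.hom

/-- The carrier of the instance at `E` is `(l·Δ_Θ)_E` (definitionally).
[cite: MochizukiEtTh2009, §5 p.327 (PDF p.101)] -/
theorem thetaSubquotientStub_lDelta [ι.range.Normal] (E : ConnectedPart (BTemp G)) :
    (thetaSubquotientStub q ι).lDelta E = LDelta q ι E.obj := rfl

/-- The transport of the instance is `map` (definitionally).
[cite: MochizukiEtTh2009, §5 p.327 (PDF p.101)] -/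
theorem thetaSubquotientStub_lDeltaMap [ι.range.Normal] {E E' : ConnectedPart (BTemp G)} (f : E ⟶ E') :
    (thetaSubquotientStub q ι).lDeltaMap f = map q ι E.property E'.property f.hom := rfl

end ThetaSubquotient

end Literature.AnabelianGeometry.EtaleTheta

end
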